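import Summits.QuantumFields.QCD.Theorems.GaussianLinkFramesFrameFMClosureTwoStarOfPaddedAux5

/-!
# Crux `GaussianLinkFrames.FrameFMClosure` (stmt-QuantumFields-17375), line `pad-the-fibre`, stub
`stub_twoStarOfPadded` — helper 6: the balanced FULL-PAD placement at the side `A = univ` on tori of side `≥ 9`

The first worked placement of the padded recipe (clause (T5) of `TwoStarBounds`, `A = univ`): for any two sites
`x, y` of the odd torus of side `2S+1`, `S ≥ 4`, take the pad about `x' = x` and the pad about `y' = y + t e₀` with
`t ∈ {0,1}` chosen so that the `0`-offset `y'₀ - x₀`, read through the balanced representative of `y₀ - x₀`, is EVEN.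
Then `x, y` lie in the `2⁴` cores, and the touched region of `R = star(x) ∪ star(y) ∪ pad(x') ∪ pad(y')` inside
`univ` — i.e. `pad(x') ∪ pad(y')` — is bipartite-balanced: the `0`-flips of the two pads (helper 5, `pad_flip`) agree
on the overlap (even offset; `pad_overlap_coord_zero`), so they glue to one nearest-neighbour pairing, and helper 5's
`balanced_touched_of_blocks` applies.  The statement `balanced_fullPads_univ` is written with the bodies of the
skeleton's `starLinks`, `padLinks`, `touched`, `Balanced` (not importable here), so that the stub file can feed it to
`PaddedCofactorDomination` with `Q₁ = padLinks S x'`, `Q₂ = padLinks S y'` (`IsPadRegion` with `M = ∅`).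
Smaller tori (`S ≤ 3`: the two pads wrap and meet with odd offsets) are NOT treated here.

References: the pad recipe is the line card of `pad-the-fibre` (triage r1-1, sharpen 1); the combinatorics is
elementary [folklore].
-/

noncomputable section

open scoped BigOperators
open Literature.MathematicalPhysics.QuantumFieldTheory Literature.MathematicalPhysics.QuantumLattice
  Literature.Probability.LatticeModels
open Summit.QuantumFields.QCD.Theorems.VonMisesCircles Summit.QuantumFields.QCD.Theorems.VonMisesCirclesC1

namespace Summit.QuantumFields.QCD.Theorems.PadTheFibreTwoStar

/-- **Offsets on the overlap of two pads.**  On the torus of side `2S+1`, `S ≥ 4`, if a site lies in the pad about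
`x` with offset `w` and in the pad about `y + t e₀` (`t ∈ {0,1}`) with offset `w'`, then
`w₀ - w'₀ = valMinAbs (y₀ - x₀) + t` as INTEGERS (both sides are small). [folklore] -/
theorem pad_overlap_coord_zero {S : ℕ} (hS : 4 ≤ S) (x y : TorusSite 4 (2 * S + 1)) (t : ℤ)
    (ht : t = 0 ∨ t = 1) (w w' : Site 4) (hw : ∀ i, -2 ≤ w i ∧ w i ≤ 1) (hw' : ∀ i, -2 ≤ w' i ∧ w' i ≤ 1)
    (h : x + Torus.proj (2 * S + 1) w =
      y + Torus.proj (2 * S + 1) (Pi.single 0 t) + Torus.proj (2 * S + 1) w') :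
    w 0 - w' 0 = (y 0 - x 0).valMinAbs + t := by
  haveI : NeZero (2 * S + 1) := ⟨by omega⟩
  have h0 := congrFun h 0
  simp only [Pi.add_apply, Torus.proj_apply, Pi.single_eq_same] at h0
  have hδ : (((y 0 - x 0).valMinAbs : ℤ) : ZMod (2 * S + 1)) = y 0 - x 0 := ZMod.coe_valMinAbs _
  have hcast : (((w 0 - w' 0 : ℤ)) : ZMod (2 * S + 1)) = ((((y 0 - x 0).valMinAbs + t : ℤ)) : ZMod (2 * S + 1)) := by
    rw [Int.cast_sub, Int.cast_add, hδ]
    linear_combination h0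
  have hb : ((y 0 - x 0).valMinAbs).natAbs ≤ (2 * S + 1) / 2 := ZMod.natAbs_valMinAbs_le _
  have hb' : |(y 0 - x 0).valMinAbs| ≤ S := by
    rw [Int.abs_eq_natAbs]
    have : (2 * S + 1) / 2 = S := by omega
    exact_mod_cast this ▸ hb
  refine (intCast_eq_intCast_iff_of_abs_sub_lt ?_).1 hcast
  rw [abs_lt]
  have h1 := (hw 0).1; have h2 := (hw 0).2; have h3 := (hw' 0).1; have h4 := (hw' 0).2
  rw [abs_le] at hb'
  constructor <;> push_cast <;> rcases ht with rfl | rfl <;> linarith [hb'.1, hb'.2]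

open Classical in
/-- **The balanced full-pad placement at `A = univ`** (`S ≥ 4`).  For all `x, y` there are pad centres `x', y'`
holding `x, y` in their cores such that the touched region of `star(x) ∪ star(y) ∪ pad(x') ∪ pad(y')` inside `univ`
is balanced (every proper two-colouring has equal classes).  Bodies of the skeleton's `starLinks`, `padLinks`,
`touched`, `Balanced` written out. [folklore] -/
theorem balanced_fullPads_univ {S : ℕ} (hS : 4 ≤ S) (x y : TorusSite 4 (2 * S + 1)) :
    ∃ x' y' : TorusSite 4 (2 * S + 1), x ∈ ebox S x' 0 ∧ y ∈ ebox S y' 0 ∧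
      let R : Finset (Edge 4 (2 * S + 1)) :=
        (Finset.univ.filter fun e : Edge 4 (2 * S + 1) => e.1 = x ∨ e.1.shift e.2 = x) ∪
        (Finset.univ.filter fun e : Edge 4 (2 * S + 1) => e.1 = y ∨ e.1.shift e.2 = y) ∪
        (Finset.univ.filter fun e : Edge 4 (2 * S + 1) => e.1 ∈ ebox S x' 1 ∧ e.1.shift e.2 ∈ ebox S x' 1) ∪
        (Finset.univ.filter fun e : Edge 4 (2 * S + 1) => e.1 ∈ ebox S y' 1 ∧ e.1.shift e.2 ∈ ebox S y' 1)
      let X : Finset (TorusSite 4 (2 * S + 1)) := (Finset.univ : Finset (TorusSite 4 (2 * S + 1))).filter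
        fun z => ∃ e ∈ R, e.1 ∈ (Finset.univ : Finset (TorusSite 4 (2 * S + 1))) ∧
          e.1.shift e.2 ∈ (Finset.univ : Finset (TorusSite 4 (2 * S + 1))) ∧ (e.1 = z ∨ e.1.shift e.2 = z)
      ∀ χ : TorusSite 4 (2 * S + 1) → Bool,
        (∀ z ∈ X, ∀ μ : Fin 4, z + Pi.single μ 1 ∈ X → χ z ≠ χ (z + Pi.single μ 1)) →
          (X.filter fun z => χ z = true).card = (X.filter fun z => χ z = false).card := by
  have hS2 : 2 ≤ S := by omega
  -- the parity shift of the second pad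
  obtain ⟨t, ht, htev⟩ : ∃ t : ℤ, (t = 0 ∨ t = 1) ∧ Even ((y 0 - x 0).valMinAbs + t) := by
    rcases Int.even_or_odd ((y 0 - x 0).valMinAbs) with h | h
    · exact ⟨0, Or.inl rfl, by simpa using h⟩
    · exact ⟨1, Or.inr rfl, h.add_one⟩
  set y' : TorusSite 4 (2 * S + 1) := y + Torus.proj (2 * S + 1) (Pi.single 0 t) with hy'
  have hxcore : x ∈ ebox S x 0 := (mem_ebox_iff _ _ _).2 ⟨0, fun i => by simp, by
    ext i; simp⟩
  have hycore : y ∈ ebox S y' 0 := by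
    refine (mem_ebox_iff _ _ _).2 ⟨-(Pi.single 0 t), fun i => ?_, ?_⟩
    · by_cases h : i = 0
      · subst h; simp only [Pi.neg_apply, Pi.single_eq_same]; rcases ht with rfl | rfl <;> norm_num
      · simp [Pi.single_eq_of_ne h]
    · ext i; simp [hy']
  refine ⟨x, y', hxcore, hycore, ?_⟩
  intro R X χ hχ
  have Cx := core_and_nbrs_subset_pad x x hxcore
  have Cy := core_and_nbrs_subset_pad y' y hycore
  have F₁ := pad_flip hS2 x
  have F₂ := pad_flip hS2 y'
  -- the two flips and their gluing
  obtain ⟨τ₁, hτ₁⟩ : ∃ τ : TorusSite 4 (2 * S + 1) → TorusSite 4 (2 * S + 1), ∀ z, τ z =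
      if z 0 - x 0 = -2 ∨ z 0 - x 0 = 0 then z + Pi.single 0 1 else z - Pi.single 0 1 := ⟨_, fun z => rfl⟩
  obtain ⟨τ₂, hτ₂⟩ : ∃ τ : TorusSite 4 (2 * S + 1) → TorusSite 4 (2 * S + 1), ∀ z, τ z =
      if z 0 - y' 0 = -2 ∨ z 0 - y' 0 = 0 then z + Pi.single 0 1 else z - Pi.single 0 1 := ⟨_, fun z => rfl⟩
  obtain ⟨σ, hσ⟩ : ∃ σ : TorusSite 4 (2 * S + 1) → TorusSite 4 (2 * S + 1), ∀ z, σ z =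
      if z ∈ ebox S x 1 then τ₁ z else τ₂ z := ⟨_, fun z => rfl⟩
  have F₁' : ∀ z ∈ ebox S x 1, τ₁ z ∈ ebox S x 1 ∧ τ₁ (τ₁ z) = z ∧
      (τ₁ z = z + Pi.single 0 1 ∨ z = τ₁ z + Pi.single 0 1) := fun z hz => by
    simpa only [hτ₁] using F₁ z hz
  have F₂' : ∀ z ∈ ebox S y' 1, τ₂ z ∈ ebox S y' 1 ∧ τ₂ (τ₂ z) = z ∧
      (τ₂ z = z + Pi.single 0 1 ∨ z = τ₂ z + Pi.single 0 1) := fun z hz => by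
    simpa only [hτ₂] using F₂ z hz
  -- the flips agree on the overlap of the two pads
  have hov : ∀ z : TorusSite 4 (2 * S + 1), z ∈ ebox S x 1 → z ∈ ebox S y' 1 → τ₁ z = τ₂ z := by
    intro z h1 h2
    obtain ⟨w, hw0, rfl⟩ := (mem_ebox_iff _ _ _).1 h1
    obtain ⟨w', hw0', h'⟩ := (mem_ebox_iff _ _ _).1 h2
    have hw : ∀ i, -2 ≤ w i ∧ w i ≤ 1 := fun i => by have := hw0 i; push_cast at this; exact this
    have hw' : ∀ i, -2 ≤ w' i ∧ w' i ≤ 1 := fun i => by have := hw0' i; push_cast at this; exact this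
    have e := pad_overlap_coord_zero hS x y t ht w w' hw hw' (by rw [h'])
    have c1 : ((x + Torus.proj (2 * S + 1) w) 0 - x 0 = -2 ∨ (x + Torus.proj (2 * S + 1) w) 0 - x 0 = 0) ↔
        (w 0 = -2 ∨ w 0 = 0) := by
      have k2 := pad_coord_zero_iff hS2 x w hw (-2) (by norm_num) (by norm_num)
      have k0 := pad_coord_zero_iff hS2 x w hw 0 (by norm_num) (by norm_num)
      push_cast at k2 k0
      rw [k2, k0]
    have c2 : ((x + Torus.proj (2 * S + 1) w) 0 - y' 0 = -2 ∨ (x + Torus.proj (2 * S + 1) w) 0 - y' 0 = 0) ↔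
        (w' 0 = -2 ∨ w' 0 = 0) := by
      have k2 := pad_coord_zero_iff hS2 y' w' hw' (-2) (by norm_num) (by norm_num)
      have k0 := pad_coord_zero_iff hS2 y' w' hw' 0 (by norm_num) (by norm_num)
      push_cast at k2 k0
      rw [h', k2, k0]
    have hpar : (w 0 = -2 ∨ w 0 = 0) ↔ (w' 0 = -2 ∨ w' 0 = 0) := by
      obtain ⟨m, hm⟩ := htev
      have h1 := (hw 0).1; have h2 := (hw 0).2; have h3 := (hw' 0).1; have h4 := (hw' 0).2
      omega
    rw [hτ₁, hτ₂]
    by_cases hc : w 0 = -2 ∨ w 0 = 0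
    · rw [if_pos (c1.2 hc), if_pos (c2.2 (hpar.1 hc))]
    · rw [if_neg (fun h => hc (c1.1 h)), if_neg (fun h => hc (hpar.2 (c2.1 h)))]
  -- `σ` on the two pads
  have hσ1 : ∀ z ∈ ebox S x 1, σ z = τ₁ z := fun z hz => by rw [hσ, if_pos hz]
  have hσ2 : ∀ z ∈ ebox S y' 1, σ z = τ₂ z := fun z hz => by
    by_cases h1 : z ∈ ebox S x 1
    · rw [hσ1 z h1, hov z h1 hz]
    · rw [hσ, if_neg h1]
  refine balanced_touched_of_blocks Finset.univ R (ebox S x 1) (ebox S y' 1) σ ?_ ?_ ?_ ?_ ?_ ?_ ?_ χ hχ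
  · -- every link of `R` joins two sites of one pad
    intro e he
    simp only [R, Finset.mem_union, Finset.mem_filter, Finset.mem_univ, true_and] at he
    rcases he with ((h | h) | h) | h
    · left
      rcases h with h | h
      · refine ⟨by rw [h]; exact Cx.1, ?_⟩
        show e.1 + Pi.single e.2 1 ∈ _
        rw [h]; exact (Cx.2 e.2).1
      · have h1 : e.1 = x - Pi.single e.2 1 := eq_sub_of_add_eq h
        exact ⟨by rw [h1]; exact (Cx.2 e.2).2, by rw [h]; exact Cx.1⟩
    · right
      rcases h with h | h
      · refine ⟨by rw [h]; exact Cy.1, ?_⟩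
        show e.1 + Pi.single e.2 1 ∈ _
        rw [h]; exact (Cy.2 e.2).1
      · have h1 : e.1 = y - Pi.single e.2 1 := eq_sub_of_add_eq h
        exact ⟨by rw [h1]; exact (Cy.2 e.2).2, by rw [h]; exact Cy.1⟩
    · exact Or.inl h
    · exact Or.inr h
  · intro z μ hz hz'
    simp only [R, Finset.mem_union, Finset.mem_filter, Finset.mem_univ, true_and]
    exact Or.inl (Or.inr ⟨hz, hz'⟩)
  · intro z μ hz hz'
    simp only [R, Finset.mem_union, Finset.mem_filter, Finset.mem_univ, true_and]
    exact Or.inr ⟨hz, hz'⟩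
  · intro z hz _
    rw [hσ1 z hz]
    exact ⟨(F₁' z hz).1, Finset.mem_univ _⟩
  · intro z hz _
    rw [hσ2 z hz]
    exact ⟨(F₂' z hz).1, Finset.mem_univ _⟩
  · intro z hz _
    rcases Finset.mem_union.1 hz with h1 | h2
    · rw [hσ1 z h1, hσ1 _ (F₁' z h1).1]
      exact (F₁' z h1).2.1
    · rw [hσ2 z h2, hσ2 _ (F₂' z h2).1]
      exact (F₂' z h2).2.1
  · intro z hz _
    rcases Finset.mem_union.1 hz with h1 | h2
    · rw [hσ1 z h1]; exact ⟨0, (F₁' z h1).2.2⟩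
    · rw [hσ2 z h2]; exact ⟨0, (F₂' z h2).2.2⟩

/-! ## Link budget of the full-pad region and the (sides) hypothesis at `A = univ` -/

/-- The star of a site has at most `8` links. [folklore] -/
theorem card_star_le {N : ℕ} [NeZero N] (x : TorusSite 4 N) :
    (Finset.univ.filter fun e : Edge 4 N => e.1 = x ∨ e.1.shift e.2 = x).card ≤ 8 := by
  have h1 := card_filter_fst_eq_le (N := N) x
  have h2 := card_filter_shift_eq_le (N := N) x
  have e1 := card_filter_or_le' (Finset.univ : Finset (Edge 4 N)) (fun e => e.1 = x) (fun e => Site.shift e.1 e.2 = x)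
  exact e1.trans (by omega)

/-- A pad has at most `1024` links (`≤ 256` sites, `4` positive directions). [folklore] -/
theorem card_padLinks_le {S : ℕ} (c : TorusSite 4 (2 * S + 1)) :
    (Finset.univ.filter fun e : Edge 4 (2 * S + 1) => e.1 ∈ ebox S c 1 ∧ e.1.shift e.2 ∈ ebox S c 1).card ≤ 1024 := by
  have h1 : (Finset.univ.filter fun e : Edge 4 (2 * S + 1) => e.1 ∈ ebox S c 1 ∧ e.1.shift e.2 ∈ ebox S c 1).card ≤
      (Finset.univ.filter fun e : Edge 4 (2 * S + 1) => e.1 ∈ ebox S c 1).card :=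
    Finset.card_le_card (Finset.monotone_filter_right _ fun e _ h => h.1)
  have h2 : (Finset.univ.filter fun e : Edge 4 (2 * S + 1) => e.1 ∈ ebox S c 1).card ≤ (ebox S c 1).card * 4 := by
    have : (Finset.univ.filter fun e : Edge 4 (2 * S + 1) => e.1 ∈ ebox S c 1) =
        (ebox S c 1).biUnion fun a => (Finset.univ : Finset (Fin 4)).image fun μ => (a, μ) := by
      ext ⟨a, μ⟩
      simp only [Finset.mem_filter, Finset.mem_univ, true_and, Finset.mem_biUnion, Finset.mem_image, Prod.mk.injEq]
      constructor
      · intro h; exact ⟨a, h, μ, rfl, rfl⟩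
      · rintro ⟨a', ha', μ', rfl, rfl⟩; exact ha'
    rw [this]
    refine Finset.card_biUnion_le.trans ?_
    calc ∑ a ∈ ebox S c 1, ((Finset.univ : Finset (Fin 4)).image fun μ => (a, μ)).card
        ≤ ∑ _a ∈ ebox S c 1, 4 := Finset.sum_le_sum fun a _ => Finset.card_image_le.trans (by simp)
      _ = (ebox S c 1).card * 4 := by rw [Finset.sum_const, smul_eq_mul]
  have hIcc : (Finset.Icc (-((1 : ℕ) : ℤ) - 1) ((1 : ℕ) : ℤ)).card = 4 := by
    rw [Int.card_Icc]; rfl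
  have hbox : (ebox S c 1).card ≤ 256 := by
    calc (ebox S c 1).card
        ≤ (Fintype.piFinset fun _ : Fin 4 => Finset.Icc (-((1 : ℕ) : ℤ) - 1) ((1 : ℕ) : ℤ)).card :=
          Finset.card_image_le
      _ = 256 := by rw [Fintype.card_piFinset, Finset.prod_const, Finset.card_univ, Fintype.card_fin, hIcc]; norm_num
  omega

/-- The full-pad region `star(x) ∪ star(y) ∪ pad(x') ∪ pad(y')` has at most `2064` links. [folklore] -/
theorem card_stars_union_pads_le {S : ℕ} (x y x' y' : TorusSite 4 (2 * S + 1)) :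
    ((Finset.univ.filter fun e : Edge 4 (2 * S + 1) => e.1 = x ∨ e.1.shift e.2 = x) ∪
        (Finset.univ.filter fun e : Edge 4 (2 * S + 1) => e.1 = y ∨ e.1.shift e.2 = y) ∪
        (Finset.univ.filter fun e : Edge 4 (2 * S + 1) => e.1 ∈ ebox S x' 1 ∧ e.1.shift e.2 ∈ ebox S x' 1) ∪
        (Finset.univ.filter fun e : Edge 4 (2 * S + 1) => e.1 ∈ ebox S y' 1 ∧ e.1.shift e.2 ∈ ebox S y' 1)).card ≤ 2064 := by
  haveI : NeZero (2 * S + 1) := ⟨by omega⟩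
  have h1 := card_star_le (N := 2 * S + 1) x
  have h2 := card_star_le (N := 2 * S + 1) y
  have h3 := card_padLinks_le (S := S) x'
  have h4 := card_padLinks_le (S := S) y'
  refine (Finset.card_union_le _ _).trans ?_
  refine (Nat.add_le_add_right ((Finset.card_union_le _ _).trans
    (Nat.add_le_add_right (Finset.card_union_le _ _) _)) _).trans ?_
  omega

open Classical in
/-- **The (sides) hypothesis of `twoStarBounds_of_regionDomination` at `A = univ`, `S ≥ 4`, from FULL-PAD
domination.**  If the `(x,y)` adjugate block of `D` is dominated (in the `∀ W ∃ W'` form of the skeleton's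
`PaddedCofactorDomination`, specialised to `A = univ` and to full pads `Q₁ = pad(x')`, `Q₂ = pad(y')`, bodies written
out) whenever `x, y` sit in the cores and the touched region is balanced, then for every `x, y` some region of
`≤ 2064` links dominates `(univ, x, y)` over every outside field (placement: `balanced_fullPads_univ`). [folklore] -/
theorem regionDom_univ_of_fullPadDom {S : ℕ} (hS : 4 ≤ S) (m₀ C₀ : ℝ) (hC₀ : 0 ≤ C₀)
    (hFP : ∀ (U : GaugeConfig 4 (2 * S + 1) (Matrix.specialUnitaryGroup (Fin 3) ℂ)) (x y x' y' : TorusSite 4 (2 * S + 1)), x ∈ ebox S x' 0 → y ∈ ebox S y' 0 →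
      (let R : Finset (Edge 4 (2 * S + 1)) :=
        (Finset.univ.filter fun e : Edge 4 (2 * S + 1) => e.1 = x ∨ e.1.shift e.2 = x) ∪
        (Finset.univ.filter fun e : Edge 4 (2 * S + 1) => e.1 = y ∨ e.1.shift e.2 = y) ∪
        (Finset.univ.filter fun e : Edge 4 (2 * S + 1) => e.1 ∈ ebox S x' 1 ∧ e.1.shift e.2 ∈ ebox S x' 1) ∪
        (Finset.univ.filter fun e : Edge 4 (2 * S + 1) => e.1 ∈ ebox S y' 1 ∧ e.1.shift e.2 ∈ ebox S y' 1)
      let X : Finset (TorusSite 4 (2 * S + 1)) := (Finset.univ : Finset (TorusSite 4 (2 * S + 1))).filter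
        fun z => ∃ e ∈ R, e.1 ∈ (Finset.univ : Finset (TorusSite 4 (2 * S + 1))) ∧
          e.1.shift e.2 ∈ (Finset.univ : Finset (TorusSite 4 (2 * S + 1))) ∧ (e.1 = z ∨ e.1.shift e.2 = z)
      ∀ χ : TorusSite 4 (2 * S + 1) → Bool,
        (∀ z ∈ X, ∀ μ : Fin 4, z + Pi.single μ 1 ∈ X → χ z ≠ χ (z + Pi.single μ 1)) →
          (X.filter fun z => χ z = true).card = (X.filter fun z => χ z = false).card) →
      ∀ W : GaugeConfig 4 (2 * S + 1) (Matrix.specialUnitaryGroup (Fin 3) ℂ), ∃ W' : GaugeConfig 4 (2 * S + 1) (Matrix.specialUnitaryGroup (Fin 3) ℂ),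
        blockNorm ((sideMatrix Finset.univ (wilsonD (fun e => if e ∈ ((Finset.univ.filter fun e : Edge 4 (2 * S + 1) => e.1 = x ∨ e.1.shift e.2 = x) ∪
        (Finset.univ.filter fun e : Edge 4 (2 * S + 1) => e.1 = y ∨ e.1.shift e.2 = y) ∪
        (Finset.univ.filter fun e : Edge 4 (2 * S + 1) => e.1 ∈ ebox S x' 1 ∧ e.1.shift e.2 ∈ ebox S x' 1) ∪
        (Finset.univ.filter fun e : Edge 4 (2 * S + 1) => e.1 ∈ ebox S y' 1 ∧ e.1.shift e.2 ∈ ebox S y' 1)) then W e else U e) m₀)).adjugate) x y ≤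
          C₀ * ‖(sideMatrix Finset.univ (wilsonD (fun e => if e ∈ ((Finset.univ.filter fun e : Edge 4 (2 * S + 1) => e.1 = x ∨ e.1.shift e.2 = x) ∪
        (Finset.univ.filter fun e : Edge 4 (2 * S + 1) => e.1 = y ∨ e.1.shift e.2 = y) ∪
        (Finset.univ.filter fun e : Edge 4 (2 * S + 1) => e.1 ∈ ebox S x' 1 ∧ e.1.shift e.2 ∈ ebox S x' 1) ∪
        (Finset.univ.filter fun e : Edge 4 (2 * S + 1) => e.1 ∈ ebox S y' 1 ∧ e.1.shift e.2 ∈ ebox S y' 1)) then W' e else U e) m₀)).det‖)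
    (x y : TorusSite 4 (2 * S + 1)) :
    ∃ R : Finset (Edge 4 (2 * S + 1)), R.card ≤ 2064 ∧
      ∀ U W : GaugeConfig 4 (2 * S + 1) (Matrix.specialUnitaryGroup (Fin 3) ℂ),
        blockNorm ((sideMatrix Finset.univ (wilsonD (fun e => if e ∈ R then W e else U e) m₀)).adjugate) x y ≤
          C₀ * ⨆ W' : GaugeConfig 4 (2 * S + 1) (Matrix.specialUnitaryGroup (Fin 3) ℂ), ‖(sideMatrix Finset.univ (wilsonD (fun e => if e ∈ R then W' e else U e) m₀)).det‖ := by
  obtain ⟨x', y', hx, hy, hbal⟩ := balanced_fullPads_univ hS x y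
  refine ⟨((Finset.univ.filter fun e : Edge 4 (2 * S + 1) => e.1 = x ∨ e.1.shift e.2 = x) ∪
        (Finset.univ.filter fun e : Edge 4 (2 * S + 1) => e.1 = y ∨ e.1.shift e.2 = y) ∪
        (Finset.univ.filter fun e : Edge 4 (2 * S + 1) => e.1 ∈ ebox S x' 1 ∧ e.1.shift e.2 ∈ ebox S x' 1) ∪
        (Finset.univ.filter fun e : Edge 4 (2 * S + 1) => e.1 ∈ ebox S y' 1 ∧ e.1.shift e.2 ∈ ebox S y' 1)), card_stars_union_pads_le x y x' y', fun U W => ?_⟩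
  exact dom_sup_of_forall_exists Finset.univ m₀ C₀ hC₀ x y _ U (hFP U x y x' y' hx hy hbal) W

open Classical in
/-- **Registered helper `stub_twoStarOfPadded_aux6` of crux stmt-QuantumFields-17375** (line `pad-the-fibre`, stub
`stub_twoStarOfPadded`): the (sides) hypothesis of the region-wise two-star package at `A = univ` on tori of side
`≥ 9`, from full-pad domination in the `∀ W ∃ W'` form (the `A = univ`, `M = ∅` instance of the skeleton's
`PaddedCofactorDomination`), one line. [folklore] -/
theorem stub_twoStarOfPadded_aux6 : ∀ (S : ℕ), 4 ≤ S → ∀ (m₀ C₀ : ℝ), 0 ≤ C₀ → (∀ (U : GaugeConfig 4 (2 * S + 1) (Matrix.specialUnitaryGroup (Fin 3) ℂ)) (x y x' y' : TorusSite 4 (2 * S + 1)), x ∈ ebox S x' 0 → y ∈ ebox S y' 0 → (let R : Finset (Edge 4 (2 * S + 1)) := (Finset.univ.filter fun e : Edge 4 (2 * S + 1) => e.1 = x ∨ e.1.shift e.2 = x) ∪ (Finset.univ.filter fun e : Edge 4 (2 * S + 1) => e.1 = y ∨ e.1.shift e.2 = y) ∪ (Finset.univ.filter fun e : Edge 4 (2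 * S + 1) => e.1 ∈ ebox S x' 1 ∧ e.1.shift e.2 ∈ ebox S x' 1) ∪ (Finset.univ.filter fun e : Edge 4 (2 * S + 1) => e.1 ∈ ebox S y' 1 ∧ e.1.shift e.2 ∈ ebox S y' 1); let X : Finset (TorusSite 4 (2 * S + 1)) := (Finset.univ : Finset (TorusSite 4 (2 * S + 1))).filter fun z => ∃ e ∈ R, e.1 ∈ (Finset.univ : Finset (TorusSite 4 (2 * S + 1))) ∧ e.1.shift e.2 ∈ (Finset.univ : Finset (TorusSite 4 (2 * S + 1))) ∧ (e.1 = z ∨ e.1.shift e.2 = z); ∀ χ : TorusSite 4 (2 * S + 1) → Bool, (∀ z ∈ X, ∀ μ : Fin 4, z + Pi.single μ 1 ∈ X → χ z ≠ χ (z + Pi.single μ 1)) → (X.filter fun z => χ z = true).card = (X.filter fun z => χ z = false).card) → ∀ W : GaugeConfig 4 (2 * S + 1) (Matrix.specialUnitaryGroup (Fin 3) ℂ), ∃ W' : GaugeConfig 4 (2 * S + 1) (Matrix.specialUnitaryGroup (Fin 3) ℂ), blockNorm ((sideMatrix Finset.univ (wilsonD (fun e => if e ∈ ((Finset.univ.filter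 fun e : Edge 4 (2 * S + 1) => e.1 = x ∨ e.1.shift e.2 = x) ∪ (Finset.univ.filter fun e : Edge 4 (2 * S + 1) => e.1 = y ∨ e.1.shift e.2 = y) ∪ (Finset.univ.filter fun e : Edge 4 (2 * S + 1) => e.1 ∈ ebox S x' 1 ∧ e.1.shift e.2 ∈ ebox S x' 1) ∪ (Finset.univ.filter fun e : Edge 4 (2 * S + 1) => e.1 ∈ ebox S y' 1 ∧ e.1.shift e.2 ∈ ebox S y' 1)) then W e else U e) m₀)).adjugate) x y ≤ C₀ * ‖(sideMatrix Finset.univ (wilsonD (fun e => if e ∈ ((Finset.univ.filter fun e : Edge 4 (2 * S + 1) => e.1 = x ∨ e.1.shift e.2 = x) ∪ (Finset.univ.filter fun e : Edge 4 (2 * S + 1) => e.1 = y ∨ e.1.shift e.2 = y) ∪ (Finset.univ.filter fun e : Edge 4 (2 * S + 1) => e.1 ∈ ebox S x' 1 ∧ e.1.shift e.2 ∈ ebox S x' 1) ∪ (Finset.univ.filter fun e : Edge 4 (2 * S + 1) => e.1 ∈ ebox S y' 1 ∧ e.1.shift e.2 ∈ ebox S y' 1)) then W' e else U e) m₀)).det‖)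 → ∀ (x y : TorusSite 4 (2 * S + 1)), ∃ R : Finset (Edge 4 (2 * S + 1)), R.card ≤ 2064 ∧ ∀ U W : GaugeConfig 4 (2 * S + 1) (Matrix.specialUnitaryGroup (Fin 3) ℂ), blockNorm ((sideMatrix Finset.univ (wilsonD (fun e => if e ∈ R then W e else U e) m₀)).adjugate) x y ≤ C₀ * ⨆ W' : GaugeConfig 4 (2 * S + 1) (Matrix.specialUnitaryGroup (Fin 3) ℂ), ‖(sideMatrix Finset.univ (wilsonD (fun e => if e ∈ R then W' e else U e) m₀)).det‖ :=
  fun _ hS m₀ C₀ hC₀ hFP x y => regionDom_univ_of_fullPadDom hS m₀ C₀ hC₀ hFP x y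

end Summit.QuantumFields.QCD.Theorems.PadTheFibreTwoStar
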